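import Literature.MathematicalPhysics.QuantumFieldTheory.OSQuantSkeletonData
import Literature.MathematicalPhysics.QuantumFieldTheory.OSRegularisedDensityWindow
import Literature.MathematicalPhysics.QuantumFieldTheory.OSBaseIndex
import HarnessLib

/-!
# The local holomorphic density with an explicit bound at the centre (towards OS II Thm. 4.1 (4.5))

Topic `Literature/MathematicalPhysics/QuantumFieldTheory`; support file for the temperedness
estimate (4.5) of Osterwalder–Schrader II, Thm. 4.1. This is the quantitative twin of
`OSPointwiseAnalyticity.schwinger_exists_holomorphic_density_near`: the same construction (skeleton
pullback, analytic deconvolution, frames), but with the explicit skeleton data of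
`OSQuantSkeletonData` (frame `qsFrame x`, base `qsXi x`, gap `qsG x`, parameter point `qsU0 x`,
radius `qsR x`), the explicit base index `baseIdx` of `OSBaseIndex`, a free Gaussian window `b`,
and the explicit density theorem `exists_holomorphic_density_skelDist_explicit`; the value of the
density at the centre `x` is bounded by the Jacobian constant of `posAff` times the explicit
deconvolution bound:

* `schwinger_exists_holomorphic_density_near_explicit` —
  `‖S(x)‖ ≤ c · deconvBound (admSplit ê hli) (regCW ξ ê g b Cv M U₀ r) a₀ ((d+M)(k+2)) r`.

## References

* K. Osterwalder, R. Schrader, *Axioms for Euclidean Green's functions II*, Comm. Math. Phys.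
  42 (1975) 281–305, Thm. 4.1 (4.5), Ch. V.1, Ch. VI.1 (6.5)–(6.13). [OsterwalderSchraderCMP1975]
-/

noncomputable section

open MeasureTheory Set Filter Module Metric Real
open _root_.Topology
open scoped InnerProductSpace RealInnerProductSpace SchwartzMap

namespace Literature.MathematicalPhysics.QuantumFieldTheory

open Literature.MathematicalPhysics.QuantumLattice (SchwingerFamily IsPositiveTimeMulti schwartzNorm)
open Literature.MathematicalPhysics.QuantumLattice.SchwingerFamily
open Literature.MathematicalPhysics.QuantumLattice.SchwingerFamily.OSSpace
open Literature.Analysis.FunctionSpaces.SchwartzAverage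
open Literature.Analysis.Distribution
open Literature.Analysis.Complex
open OSFrames

variable {d : ℕ} [NeZero d] (𝔖 : SchwingerFamily (EuclideanSpace ℝ (Fin d))) (hE1 : 𝔖.IsEuclideanCovariant)
  (hE2 : 𝔖.IsOSReflectionPositive) {k : ℕ}
  {s : ℕ} {Cv : ℕ → ℝ} (hCv : ∀ n, 0 ≤ Cv n)
  (hv : ∀ (n : ℕ) (K : 𝓢((Fin n → EuclideanSpace ℝ (Fin d)), ℂ)) (hK : IsPositiveTimeMulti K),
    ‖ι 𝔖 hE2 (δ 𝔖 hE2 (mkGen K hK))‖ ≤ Cv n * schwartzNorm ((n + n) * s) K)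
  {M : ℕ} (hM : (k + 1 + (k + 1)) * s ≤ M)
  {s₀ : ℕ} {C₀ : ℝ} (hC₀ : 0 ≤ C₀)
  (hσ : ∀ F : 𝓢((Fin (k + 2) → EuclideanSpace ℝ (Fin d)), ℂ), ‖𝔖 (k + 2) F‖ ≤ C₀ * schwartzNorm s₀ F)
  {b : ℝ} (hb : 0 < b)

include hE1 hCv hv hM hC₀ hσ hb

/-- **The local holomorphic density with an explicit bound at the centre** (quantitative twin of
`schwinger_exists_holomorphic_density_near`): for `x` in the ordered region, a radius `r₀` of the
base bumps with `2r₀ < g` and a window `b > 0`, there are the Jacobian constant `c > 0` of the affine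
position map of the explicit skeleton data, a radius `ρ > 0` and `S` holomorphic and bounded on the
complex ball about `x` representing `𝔖_{k+2}` near `x`, with
`‖S(x)‖ ≤ c · deconvBound (admSplit ê hli) (regCW …) a₀ ((d+M)(k+2)) r`. [cite: OsterwalderSchraderCMP1975, Thm. 4.1 (4.5); Ch. V.1; Ch. VI.1 (6.5)–(6.13)] -/
theorem schwinger_exists_holomorphic_density_near_explicit (x : Fin (k + 2) → EuclideanSpace ℝ (Fin d))
    (hx : x ∈ orderedRegion k d) {r₀ : ℝ} (hr₀ : 0 < r₀) (hr₀g : 2 * r₀ < qsG x) :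
    ∃ c : ℝ, 0 < c ∧
      (∀ Φ : (Fin (k + 2) → EuclideanSpace ℝ (Fin d)) → ℂ,
        ∫ U, Φ (posAff (qsXi x) (qsFrame x) (linearIndependent_qsFrame hx) U) = (c : ℂ) * ∫ y, Φ y) ∧
      ∃ ρ : ℝ, 0 < ρ ∧ ∃ S : (Fin (k + 2) → Fin d → ℂ) → ℂ,
        DifferentiableOn ℂ S (ball (cfgPt x) ρ) ∧ (∃ B : ℝ, ∀ ζ ∈ ball (cfgPt x) ρ, ‖S ζ‖ ≤ B) ∧
        (∀ F : 𝓢((Fin (k + 2) → EuclideanSpace ℝ (Fin d)), ℂ),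
          tsupport (F : (Fin (k + 2) → EuclideanSpace ℝ (Fin d)) → ℂ) ⊆ Metric.ball x ρ →
            𝔖 (k + 2) F = ∫ y, S (cfgPt y) * F y) ∧
        ‖S (cfgPt x)‖ ≤ c * deconvBound (admSplit (qsFrame x) (linearIndependent_qsFrame hx))
          (fun a : AdmIdx k d r₀ => regCW (qsXi x) (qsFrame x) (qsG x) b Cv M
            (qsU0 x (linearIndependent_qsFrame hx)) (qsR x) a.1)
          (baseIdx (qsFrame x) (linearIndependent_qsFrame hx) k hr₀) ((d + M) * (k + 2)) (qsR x) := by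
  set ê := qsFrame x with hê
  set hli : LinearIndependent ℝ ê := linearIndependent_qsFrame hx
  set ξ := qsXi x with hξ
  set U₀ := qsU0 x hli with hU₀def
  set r := qsR x with hr
  have hr0 : 0 < r := qsR_pos hx
  obtain ⟨c, hc, hcv⟩ := exists_integral_comp_posAff ξ ê hli
  have hU₀ : posAff ξ ê hli U₀ = x := posAff_qsU0 x hli
  obtain ⟨H, hH, hB, hHT⟩ := exists_holomorphic_density_skelDist_explicit 𝔖 hE1 hE2 ξ ê hli hb (norm_qsFrame hx)
    (inner_qsFrame_nonneg hx) (qsG_le_inner_qsXi hx) hr₀g hr₀ hCv hv hM hC₀ hσ U₀ hr0 (qsR_le_tailR x hli)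
    (baseIdx ê hli k hr₀) (integral_skelFamily_baseIdx ξ ê hli hr₀ hc hcv)
  -- the inverse linear map, its complexification and the radius in configuration space
  set L : (Fin (k + 2) → EuclideanSpace ℝ (Fin d)) →L[ℝ] EuclideanSpace ℝ (Fin (k + 2) × Fin d) :=
    ((posLinCLE (k := k) ê hli).symm).toContinuousLinearMap with hL
  have hLx : L (x - pbase ξ) = U₀ := by
    rw [hL, ← hU₀, posAff, add_sub_cancel_left]
    exact (posLinCLE ê hli).symm_apply_apply U₀
  set ρ : ℝ := r / (2 * (max ‖L‖ (cplxLBound L) + 1)) with hρ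
  have hM0 : 0 ≤ max ‖L‖ (cplxLBound L) := le_max_of_le_left (norm_nonneg _)
  have hρ0 : 0 < ρ := by positivity
  have hρN : ‖L‖ * ρ < r / 2 := by
    have h1 : ‖L‖ * ρ ≤ max ‖L‖ (cplxLBound L) * ρ := mul_le_mul_of_nonneg_right (le_max_left _ _) hρ0.le
    have h2 : max ‖L‖ (cplxLBound L) * ρ < r / 2 := by
      rw [hρ, mul_div_assoc', div_lt_div_iff₀ (by positivity) (by positivity)]
      nlinarith
    linarith
  have hρA : cplxLBound L * ρ < r / 2 := by
    have h1 : cplxLBound L * ρ ≤ max ‖L‖ (cplxLBound L) * ρ := mul_le_mul_of_nonneg_right (le_max_right _ _) hρ0.le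
    have h2 : max ‖L‖ (cplxLBound L) * ρ < r / 2 := by
      rw [hρ, mul_div_assoc', div_lt_div_iff₀ (by positivity) (by positivity)]
      nlinarith
    linarith
  have hcentre : cplxL L (cfgPt x - cfgPt (pbase ξ)) = eRealPt U₀ := by
    rw [← cfgPt_sub, cplxL_cfgPt, hLx]
  have hmaps : MapsTo (fun ζ => cplxL L (ζ - cfgPt (pbase ξ))) (ball (cfgPt x) ρ) (ball (eRealPt U₀) (r / 2)) :=
    fun ζ hζ => by rw [← hcentre]; exact cplxL_mem_ball L hζ hρA _
  set Bd : ℝ := deconvBound (admSplit ê hli) (fun a : AdmIdx k d r₀ => regCW ξ ê (qsG x) b Cv M U₀ r a.1)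
    (baseIdx ê hli k hr₀) ((d + M) * (k + 2)) r with hBd
  refine ⟨c, hc, hcv, ρ, hρ0, fun ζ => (c : ℂ) * H (cplxL L (ζ - cfgPt (pbase ξ))), ?_, ⟨c * Bd, fun ζ hζ => ?_⟩,
    fun F hF => ?_, ?_⟩
  · exact (differentiableOn_const _).mul (hH.comp (differentiable_cplxL L _).differentiableOn hmaps)
  · rw [norm_mul, Complex.norm_real, Real.norm_eq_abs, abs_of_pos hc]
    exact mul_le_mul_of_nonneg_left (hB _ (hmaps hζ)) hc.le
  · have hsupp : tsupport (skelPush ξ ê hli F : EuclideanSpace ℝ (Fin (k + 2) × Fin d) → ℂ) ⊆ Metric.ball U₀ (r / 2) :=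
      (tsupport_skelPush_subset ξ ê hli hF hU₀).trans (closedBall_subset_ball hρN)
    rw [schwinger_eq_skelDist_skelPush ξ ê hli 𝔖 F, hHT _ hsupp]
    have hΦ := hcv fun y => H (eRealPt (L (y - pbase ξ))) * F y
    have hlhs : (fun U => H (eRealPt (L (posAff ξ ê hli U - pbase ξ))) * F (posAff ξ ê hli U)) =
        fun U => H (eRealPt U) * skelPush ξ ê hli F U := by
      funext U
      rw [skelPush_apply, posAff, add_sub_cancel_left, hL]
      erw [(posLinCLE ê hli).symm_apply_apply U]
    rw [hlhs] at hΦ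
    rw [hΦ, ← integral_const_mul]
    refine integral_congr_ae (Eventually.of_forall fun y => ?_)
    simp only
    rw [← cfgPt_sub, cplxL_cfgPt, mul_assoc]
  · -- the bound at the centre
    simp only
    rw [hcentre, norm_mul, Complex.norm_real, Real.norm_eq_abs, abs_of_pos hc]
    exact mul_le_mul_of_nonneg_left (hB _ (mem_ball_self (by positivity))) hc.le

end Literature.MathematicalPhysics.QuantumFieldTheory
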